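import Literature.NumberTheory.Transcendental.DiazConstruction
import Literature.NumberTheory.Transcendental.DiazPoints
import Literature.NumberTheory.Transcendental.IntegerTaylor
import Literature.NumberTheory.Transcendental.InterpolationBound
import HarnessLib

/-!
# Diaz 1989, Théorème 1 — the modified polynomials `Q_{μj}` and the upper bound for `|Q_{μj}(θ)|`

Topic `Literature/NumberTheory/Transcendental` (trunk T-TRANSCEND). Decomposition step for the
named fact `Literature.NumberTheory.Transcendental.Diaz1989_thm1` (`DiazMain.lean`): §II-3-1 and §II-3-2 of G. Diaz,
J. Number Theory 31 (1989), pp. 6–11, on top of `DiazConstruction.lean` (the `P_{dλ}`, `Q_μ` and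
Siegel's step), `IntegerTaylor.lean` (`P_{dλj} = (1/j!)D^jP_{dλ}`), `DiazPoints.lean` (the set
`𝓔(M)`) and `InterpolationBound.lean` (the extrapolation).

* §II-3-1: `Pj p a j = taylorCoeff j (P_{dλ})`, `Qj p μ j = ∑ P_{dλj} R_{dλμ}`; the minimal index
  `IsMinIdx p θ̃ j` of a point `θ̃` (some `P_{dλj}(θ̃) ≠ 0`, all `P_{dλj'}(θ̃) = 0` for `|j'| < |j|`)
  and its existence `exists_isMinIdx`.
* §II-3-2: the decomposition `Q_{μj}(θ) = A_{μj} + B_{μj}` (`aeval_Qj_eq_A_add_Ft`) with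
  `B_{μj} = F̃(μ.v)`, `F̃(z) = ∑ P_{dλj}(θ̃) z^d e^{(λ.u)z}` (`Ft`); for `|μ| < M` the key identity gives
  `F̃(μ.v) = ∑ P_{dλj}(θ̃)(R_{dλμ}(θ) - R_{dλμ}(θ̃))` (`Ft_muv_eq_of_lt`); and the norm bounds
  (a) `norm_A_le`, (b) `norm_Ft_muv_le_of_lt`, the growth bound `norm_Ft_le`, and (c)+(d) the
  final estimate `norm_aeval_Qj_le` obtained from the interpolation estimate on `𝓔(M)`.

All sizes are expressed through the height `H` of Siegel's step and explicit monomials in the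
parameters; the choice of parameters (§II-4) is made in the sequel. Everything here is proved.

## References

* G. Diaz, *Grands degrés de transcendance pour des familles d'exponentielles*, J. Number Theory
  31 (1989), 1–23, §II-3-1, §II-3-2, pp. 6–11.
-/

noncomputable section

open MvPolynomial Finset Finsupp Literature.NumberTheory.Transcendental.Chudnovsky Literature.NumberTheory.Transcendental.Taylor

namespace Literature.NumberTheory.Transcendental

namespace DiazThm1

variable {m n D L M : ℕ}

/-! ### §II-3-1: the modified polynomials -/

/-- `P_{dλj} = (1/j!) D^j P_{dλ} ∈ ℤ[Y]`. [cite: Diaz1989, §II-3-1 p. 6] -/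
def Pj (p : Unk m n D L M → ℤ) (a : DL n D L) (j : Var m n →₀ ℕ) : MvPolynomial (Var m n) ℤ :=
  taylorCoeff j (Pdl p a)

/-- `Q_{μj} = ∑_{d,λ} P_{dλj} R_{dλμ} ∈ ℤ[Y]`. [cite: Diaz1989, §II-3-1 p. 6] -/
def Qj (p : Unk m n D L M → ℤ) (μ : Fin m → ℕ) (j : Var m n →₀ ℕ) : MvPolynomial (Var m n) ℤ :=
  ∑ a : DL n D L, Pj p a j * Rfac a μ

/-- **The minimal index `j(θ̃)`** (Diaz 1989, §II-3-1): `j` is a minimal index at `θ̃` if some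
`P_{dλj}(θ̃) ≠ 0` and `P_{dλj'}(θ̃) = 0` for all `(d,λ)` and all `j'` of length `< |j|`.
[cite: Diaz1989, §II-3-1 p. 6] -/
def IsMinIdx (p : Unk m n D L M → ℤ) (θ' : Var m n → ℂ) (j : Var m n →₀ ℕ) : Prop :=
  (∃ a, aeval θ' (Pj p a j) ≠ 0) ∧ ∀ a j', degree j' < degree j → aeval θ' (Pj p a j') = 0

/-- **Existence of a minimal index** at every point, as soon as some `P_{dλ} ≠ 0` ("`J(θ̃)` est
fini non vide … la fonction longueur atteint son minimum", p. 6).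
[cite: Diaz1989, §II-3-1 p. 6] -/
theorem exists_isMinIdx {p : Unk m n D L M → ℤ} (hp : p ≠ 0) (θ' : Var m n → ℂ) :
    ∃ j, IsMinIdx p θ' j := by
  classical
  -- some `P_{dλ} ≠ 0`, hence some Taylor coefficient does not vanish at `θ'`
  obtain ⟨a₀, ha₀⟩ : ∃ a, Pdl p a ≠ 0 := by
    by_contra h
    push Not at h
    exact hp (eq_zero_of_Pdl_eq_zero h)
  have hex : ∃ N : ℕ, ∃ a j, degree j = N ∧ aeval θ' (Pj p a j) ≠ 0 := by
    by_contra h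
    push Not at h
    apply ha₀
    refine eq_zero_of_forall_eval₂_taylorCoeff (f := algebraMap ℤ ℂ)
      (RingHom.injective_int (algebraMap ℤ ℂ)) θ' fun j => ?_
    have := h (degree j) a₀ j rfl
    simpa [Pj, MvPolynomial.aeval_def] using this
  set N := Nat.find hex with hN
  obtain ⟨a, j, hj, hne⟩ := Nat.find_spec hex
  refine ⟨j, ⟨a, hne⟩, fun a' j' hlt => ?_⟩
  by_contra hne'
  have : Nat.find hex ≤ degree j' := Nat.find_min' hex ⟨a', j', rfl, hne'⟩
  rw [hj] at hlt
  omega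

/-! ### §II-3-2: the decomposition `Q_{μj}(θ) = A_{μj} + F̃(μ.v)` -/

/-- The entire function `F̃(z) = ∑_{d,λ} P_{dλj}(θ̃) z^d e^{(λ.u)z}` attached to `(j, θ̃)`.
[cite: Diaz1989, §II-3-2 (c) p. 9] -/
def Ft (u : Fin n → ℂ) (p : Unk m n D L M → ℤ) (j : Var m n →₀ ℕ) (θ' : Var m n → ℂ) (z : ℂ) : ℂ :=
  ∑ a : DL n D L, aeval θ' (Pj p a j) * (z ^ (a.1 : ℕ) * Complex.exp (lamu u a.2 * z))

/-- `F̃` is entire. [folklore] -/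
theorem differentiable_Ft (u : Fin n → ℂ) (p : Unk m n D L M → ℤ) (j : Var m n →₀ ℕ)
    (θ' : Var m n → ℂ) : Differentiable ℂ (Ft u p j θ') := by
  unfold Ft
  refine Differentiable.fun_sum fun a _ => ?_
  refine (differentiable_const _).mul ?_
  exact (differentiable_pow _).mul (((differentiable_const _).mul differentiable_id).cexp)

/-- The term `A_{μj} = ∑ (P_{dλj}(θ) - P_{dλj}(θ̃)) R_{dλμ}(θ)`. [cite: Diaz1989, §II-3-2 p. 7] -/
def Aterm (u : Fin n → ℂ) (v : Fin m → ℂ) (p : Unk m n D L M → ℤ) (μ : Fin m → ℕ)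
    (j : Var m n →₀ ℕ) (θ' : Var m n → ℂ) : ℂ :=
  ∑ a : DL n D L, (aeval (theta u v) (Pj p a j) - aeval θ' (Pj p a j)) *
    aeval (theta u v) (Rfac a μ)

/-- **`Q_{μj}(θ) = A_{μj} + F̃(μ.v)`** (Diaz 1989, p. 7 and (c) p. 9: `B_{μj} = |F̃(μ.v)|`).
[cite: Diaz1989, §II-3-2 pp. 7, 9] -/
theorem aeval_Qj_eq_A_add_Ft (u : Fin n → ℂ) (v : Fin m → ℂ) (p : Unk m n D L M → ℤ)
    (μ : Fin m → ℕ) (j : Var m n →₀ ℕ) (θ' : Var m n → ℂ) :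
    aeval (theta u v) (Qj p μ j) = Aterm u v p μ j θ' + Ft u p j θ' (muv v μ) := by
  unfold Qj Aterm Ft
  rw [map_sum, ← Finset.sum_add_distrib]
  refine Finset.sum_congr rfl fun a _ => ?_
  rw [map_mul, aeval_Rfac]
  ring

/-- **The key identity at work**: for `|μ| < M` (so that `Q_μ = 0`) and `j` a minimal index at
`θ̃`, `F̃(μ.v) = ∑ P_{dλj}(θ̃) (R_{dλμ}(θ) - R_{dλμ}(θ̃))` (Diaz 1989, p. 9).
[cite: Diaz1989, §II-3-2 (b) p. 9] -/
theorem Ft_muv_eq_of_vanish (u : Fin n → ℂ) (v : Fin m → ℂ) {p : Unk m n D L M → ℤ}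
    {μ : Fin m → ℕ} (hQ : Q p μ = 0) {j : Var m n →₀ ℕ} {θ' : Var m n → ℂ}
    (hj : IsMinIdx p θ' j) :
    Ft u p j θ' (muv v μ) = ∑ a : DL n D L, aeval θ' (Pj p a j) *
      (aeval (theta u v) (Rfac a μ) - aeval θ' (Rfac a μ)) := by
  classical
  have key : ∑ a : DL n D L, aeval θ' (Pj p a j) * aeval θ' (Rfac a μ) = 0 := by
    have := sum_eval_taylorCoeff_mul_eq_zero (algebraMap ℤ ℂ) θ' Finset.univ (Pdl p)
      (fun a => Rfac a μ) (by simpa [Q] using hQ) j (fun a _ j' hj' => by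
        have := hj.2 a j' hj'
        simpa [Pj, MvPolynomial.aeval_def] using this)
    simpa [Pj, MvPolynomial.aeval_def] using this
  unfold Ft
  simp only [mul_sub]
  rw [Finset.sum_sub_distrib, key, sub_zero]
  refine Finset.sum_congr rfl fun a _ => ?_
  rw [aeval_Rfac]

/-! ### Sizes of the polynomials -/

/-- The degree bound `T₀ = m(D-1) + nm(LM-1)` for the `P_{dλ}` (and the `P_{dλj}`).
[cite: Diaz1989, §II-3-2 (2) p. 8] -/
def T0 (m n D L M : ℕ) : ℕ := m * (D - 1) + n * m * (L * M - 1)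

/-- `deg P_{dλj} ≤ T₀`. [cite: Diaz1989, §II-3-2 (2) p. 8] -/
theorem totalDegree_Pj_le (p : Unk m n D L M → ℤ) (a : DL n D L) (j : Var m n →₀ ℕ) :
    (Pj p a j).totalDegree ≤ T0 m n D L M := by
  classical
  exact (totalDegree_taylorCoeff_le j (Pdl p a)).trans (totalDegree_Pdl_le p a)

/-- `L(P_{dλ}) ≤ #ExpIdx · H` if all unknowns are `≤ H` in absolute value. [folklore] -/
theorem l1_Pdl_le (p : Unk m n D L M → ℤ) {H : ℝ} (hH : ∀ w, |(p w : ℝ)| ≤ H) (a : DL n D L) :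
    l1 (Pdl p a) ≤ Fintype.card (ExpIdx m n D L M) * H := by
  unfold Pdl
  refine (wnorm_sum_le _ _ _).trans ?_
  calc ∑ ε : ExpIdx m n D L M, wnorm (normRingSeminorm ℤ) (monomial (toExp ε) (p (a, ε)))
      ≤ ∑ _ε : ExpIdx m n D L M, H := Finset.sum_le_sum fun ε _ => by
        rw [wnorm_monomial, normRingSeminorm_int_apply]; exact hH (a, ε)
    _ = Fintype.card (ExpIdx m n D L M) * H := by simp

/-- **Heights of the `P_{dλj}`**: `L(P_{dλj}) ≤ 2^{T₀} · #ExpIdx · H` (Diaz 1989, (3)).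
[cite: Diaz1989, §II-3-2 (3) p. 8] -/
theorem l1_Pj_le (p : Unk m n D L M → ℤ) {H : ℝ} (hH : ∀ w, |(p w : ℝ)| ≤ H)
    (a : DL n D L) (j : Var m n →₀ ℕ) :
    l1 (Pj p a j) ≤ 2 ^ T0 m n D L M * (Fintype.card (ExpIdx m n D L M) * H) := by
  classical
  unfold Pj
  refine (l1_taylorCoeff_le j (Pdl p a)).trans ?_
  exact mul_le_mul (pow_le_pow_right₀ (by norm_num) (totalDegree_Pdl_le p a))
    (l1_Pdl_le p hH a) (wnorm_nonneg _ _) (by positivity)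

/-- The common bound `Pmax = 2^{T₀} #ExpIdx H A^{T₀}` for the values `|P_{dλj}(θ̃)|` at points of the
polydisc `max |θ̃ᵢ| ≤ A`. [cite: Diaz1989, §II-3-2 (b) p. 9 (|P_{dλj}(θ̃)| ≤ exp c₆(D log M + LM))] -/
def Pmax (m n D L M : ℕ) (H A : ℝ) : ℝ :=
  2 ^ T0 m n D L M * (Fintype.card (ExpIdx m n D L M) * H) * A ^ T0 m n D L M

/-- `Pmax ≥ 0` for `H, A ≥ 0`. [folklore] -/
theorem Pmax_nonneg {H A : ℝ} (hH : 0 ≤ H) (hA : 0 ≤ A) : 0 ≤ Pmax m n D L M H A := by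
  unfold Pmax; positivity

/-- `|P_{dλj}(θ̃)| ≤ Pmax` on the polydisc `max |θ̃ᵢ| ≤ A` (`A ≥ 1`).
[cite: Diaz1989, §II-3-2 (b) p. 9] -/
theorem norm_aeval_Pj_le (p : Unk m n D L M → ℤ) {H A : ℝ} (hH0 : 0 ≤ H)
    (hH : ∀ w, |(p w : ℝ)| ≤ H) (hA : 1 ≤ A) {θ' : Var m n → ℂ} (hθ' : ∀ i, ‖θ' i‖ ≤ A)
    (a : DL n D L) (j : Var m n →₀ ℕ) :
    ‖aeval θ' (Pj p a j)‖ ≤ Pmax m n D L M H A := by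
  refine (norm_aeval_le_l1 (Pj p a j) θ' hA hθ').trans ?_
  unfold Pmax
  exact mul_le_mul (l1_Pj_le p hH a j) (pow_le_pow_right₀ hA (totalDegree_Pj_le p a j))
    (by positivity) (by positivity)

/-- `|P_{dλj}(θ) - P_{dλj}(θ̃)| ≤ Pmax · T₀ · ε` when `max |θᵢ - θ̃ᵢ| ≤ ε` and both points lie in the
polydisc `max |·| ≤ A` (the "Lemme" of p. 7 applied as in (a), p. 8).
[cite: Diaz1989, §II-3-2 (a) p. 8] -/
theorem norm_aeval_Pj_sub_le (p : Unk m n D L M → ℤ) {H A ε : ℝ} (hH0 : 0 ≤ H)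
    (hH : ∀ w, |(p w : ℝ)| ≤ H) (hA : 1 ≤ A) (hε0 : 0 ≤ ε) {θ₀ θ' : Var m n → ℂ}
    (hθ₀ : ∀ i, ‖θ₀ i‖ ≤ A) (hθ' : ∀ i, ‖θ' i‖ ≤ A) (hε : ∀ i, ‖θ₀ i - θ' i‖ ≤ ε)
    (a : DL n D L) (j : Var m n →₀ ℕ) :
    ‖aeval θ₀ (Pj p a j) - aeval θ' (Pj p a j)‖ ≤ Pmax m n D L M H A * T0 m n D L M * ε := by
  refine (norm_aeval_sub_aeval_le (Pj p a j) θ₀ θ' hA hε0 hθ₀ hθ' hε).trans ?_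
  have hdeg := totalDegree_Pj_le p a j
  have hdeg' : ((Pj p a j).totalDegree : ℝ) ≤ T0 m n D L M := by exact_mod_cast hdeg
  unfold Pmax
  have hl1 := l1_Pj_le p hH a j
  have hpow : A ^ (Pj p a j).totalDegree ≤ A ^ T0 m n D L M := pow_le_pow_right₀ hA hdeg
  calc l1 (Pj p a j) * (Pj p a j).totalDegree * A ^ (Pj p a j).totalDegree * ε
      = (l1 (Pj p a j) * A ^ (Pj p a j).totalDegree) * (Pj p a j).totalDegree * ε := by ring
    _ ≤ (2 ^ T0 m n D L M * (Fintype.card (ExpIdx m n D L M) * H) * A ^ T0 m n D L M) *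
          T0 m n D L M * ε := by
        gcongr

/-! ### Sizes of the cofactors `R_{dλμ}` -/

/-- `|λ.u| ≤ L ∑|u_h|`. [folklore] -/
theorem norm_lamu_le (u : Fin n → ℂ) (lam : Fin n → Fin L) :
    ‖lamu u lam‖ ≤ L * ∑ h, ‖u h‖ := by
  unfold lamu
  calc ‖∑ h, ((lam h : ℕ) : ℂ) * u h‖ ≤ ∑ h, ‖((lam h : ℕ) : ℂ) * u h‖ := norm_sum_le _ _
    _ ≤ ∑ h, (L : ℝ) * ‖u h‖ := Finset.sum_le_sum fun h _ => by
        rw [norm_mul, Complex.norm_natCast]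
        exact mul_le_mul_of_nonneg_right (by exact_mod_cast (lam h).isLt.le) (norm_nonneg _)
    _ = L * ∑ h, ‖u h‖ := by rw [Finset.mul_sum]

/-- `|μ.v| ≤ M' ∑|v_k|` for `μ ∈ ℕ^m(M')`. [folklore] -/
theorem norm_muv_le (v : Fin m → ℂ) {M' : ℕ} {μ : Fin m → ℕ} (hμ : ∀ k, μ k < M') :
    ‖muv v μ‖ ≤ M' * ∑ k, ‖v k‖ :=
  norm_muv_le_of_mem_box v (Behrend.mem_box.mpr hμ)

/-- **`|R_{dλμ}(θ)| ≤ (1 + M'V)^D exp(L U M' V)`** for `μ ∈ ℕ^m(M')`, `U = ∑|u_h|`, `V = ∑|v_k|`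
(Diaz 1989, p. 8: `|R_{dλμ}(θ)| ≤ exp c₄(LM₁ + D log M₁)`). [cite: Diaz1989, §II-3-2 (a) p. 8] -/
theorem norm_aeval_Rfac_le (u : Fin n → ℂ) (v : Fin m → ℂ) (a : DL n D L) {M' : ℕ}
    {μ : Fin m → ℕ} (hμ : ∀ k, μ k < M') :
    ‖aeval (theta u v) (Rfac a μ)‖ ≤
      (1 + M' * ∑ k, ‖v k‖) ^ D * Real.exp (L * (∑ h, ‖u h‖) * (M' * ∑ k, ‖v k‖)) := by
  rw [aeval_Rfac, norm_mul, norm_pow, Complex.norm_exp]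
  have hmuv := norm_muv_le v hμ
  have hV : 0 ≤ (M' : ℝ) * ∑ k, ‖v k‖ := by positivity
  refine mul_le_mul ?_ ?_ (by positivity) (by positivity)
  · calc ‖muv v μ‖ ^ (a.1 : ℕ) ≤ (1 + M' * ∑ k, ‖v k‖) ^ (a.1 : ℕ) :=
          pow_le_pow_left₀ (norm_nonneg _) (by linarith) _
      _ ≤ (1 + M' * ∑ k, ‖v k‖) ^ D := pow_le_pow_right₀ (by linarith) a.1.isLt.le
  · refine Real.exp_le_exp.mpr ?_
    calc (lamu u a.2 * muv v μ).re ≤ ‖lamu u a.2 * muv v μ‖ := Complex.re_le_norm _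
      _ = ‖lamu u a.2‖ * ‖muv v μ‖ := norm_mul _ _
      _ ≤ (L * ∑ h, ‖u h‖) * (M' * ∑ k, ‖v k‖) :=
          mul_le_mul (norm_lamu_le u a.2) hmuv (norm_nonneg _) (by positivity)

/-- The degree bound `T₁(M') = D + nmLM'` for the cofactors `R_{dλμ}`, `μ ∈ ℕ^m(M')`. [folklore] -/
def T1 (m n D L M' : ℕ) : ℕ := D + n * m * (L * M')

/-- `deg R_{dλμ} ≤ T₁(M')` for `μ ∈ ℕ^m(M')` (Diaz 1989, p. 9: `deg R_{dλμ} ≤ mD + nmLM`).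
[cite: Diaz1989, §II-3-2 (b) p. 9] -/
theorem totalDegree_Rfac_le (a : DL n D L) {M' : ℕ} {μ : Fin m → ℕ} (hμ : ∀ k, μ k < M') :
    (Rfac a μ : MvPolynomial (Var m n) ℤ).totalDegree ≤ T1 m n D L M' := by
  classical
  unfold Rfac T1
  refine (totalDegree_mul _ _).trans (Nat.add_le_add ?_ ?_)
  · refine (totalDegree_pow _ _).trans ?_
    have hlin : (linForm m n μ).totalDegree ≤ 1 := by
      unfold linForm
      refine totalDegree_finsetSum_le fun k _ => (totalDegree_mul _ _).trans ?_
      rw [totalDegree_C, zero_add]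
      calc (X (Sum.inl k) : MvPolynomial (Var m n) ℤ).totalDegree
          ≤ (Finsupp.single (Sum.inl k) 1).sum fun _ => id := totalDegree_monomial_le _ _
        _ = 1 := by simp
    calc (a.1 : ℕ) * (linForm m n μ).totalDegree ≤ (a.1 : ℕ) * 1 := Nat.mul_le_mul_left _ hlin
      _ ≤ D := by have := a.1.isLt; omega
  · refine (totalDegree_monomial_le _ _).trans ?_
    rw [Finsupp.sum_fintype _ _ (fun _ => rfl), Fintype.sum_sum_type]
    simp only [id_eq, lamMu_inl, Finset.sum_const_zero, zero_add, lamMu_inr]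
    calc ∑ q : Fin n × Fin m, (a.2 q.1 : ℕ) * μ q.2 ≤ ∑ _q : Fin n × Fin m, L * M' :=
          Finset.sum_le_sum fun q _ => Nat.mul_le_mul (a.2 q.1).isLt.le (hμ q.2).le
      _ = n * m * (L * M') := by simp [Fintype.card_prod]

/-- **`|R_{dλμ}(θ) - R_{dλμ}(θ̃)| ≤ (mM')^D · T₁(M') · A^{T₁(M')} · ε`** for `μ ∈ ℕ^m(M')`, `m ≥ 1`
(Diaz 1989, p. 9). [cite: Diaz1989, §II-3-2 (b) p. 9] -/
theorem norm_aeval_Rfac_sub_le (hm : 1 ≤ m) (a : DL n D L) {M' : ℕ} {μ : Fin m → ℕ}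
    (hμ : ∀ k, μ k < M') {A ε : ℝ} (hA : 1 ≤ A) (hε0 : 0 ≤ ε) {θ₀ θ' : Var m n → ℂ}
    (hθ₀ : ∀ i, ‖θ₀ i‖ ≤ A) (hθ' : ∀ i, ‖θ' i‖ ≤ A) (hε : ∀ i, ‖θ₀ i - θ' i‖ ≤ ε) :
    ‖aeval θ₀ (Rfac a μ) - aeval θ' (Rfac a μ)‖ ≤
      ((m : ℝ) * M') ^ D * T1 m n D L M' * A ^ T1 m n D L M' * ε := by
  refine (norm_aeval_sub_aeval_le (Rfac a μ) θ₀ θ' hA hε0 hθ₀ hθ' hε).trans ?_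
  have hdeg := totalDegree_Rfac_le (m := m) (n := n) (D := D) (L := L) a hμ
  have hdeg' : ((Rfac a μ : MvPolynomial (Var m n) ℤ).totalDegree : ℝ) ≤ T1 m n D L M' := by
    exact_mod_cast hdeg
  have hl1 := l1_Rfac_le (n := n) (D := D) hm a hμ
  have hpow : A ^ (Rfac a μ : MvPolynomial (Var m n) ℤ).totalDegree ≤ A ^ T1 m n D L M' :=
    pow_le_pow_right₀ hA hdeg
  gcongr

/-! ### The three estimates (a), (b) and the growth of `F̃` -/

/-- `∑ᵢ fᵢ ≤ #ι · b` when every `fᵢ ≤ b`. [folklore] -/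
theorem sum_univ_le_card_mul {ι : Type*} [Fintype ι] (f : ι → ℝ) (b : ℝ) (h : ∀ i, f i ≤ b) :
    ∑ i, f i ≤ Fintype.card ι * b := by
  calc ∑ i, f i ≤ ∑ _i : ι, b := Finset.sum_le_sum fun i _ => h i
    _ = Fintype.card ι * b := by rw [Finset.sum_const, Finset.card_univ, nsmul_eq_mul]

/-- **(a)** `|A_{μj}| ≤ #DL · Pmax T₀ ε · (1 + M₁V)^D e^{LUM₁V}` for `μ ∈ ℕ^m(M₁)` (Diaz 1989, (4):
`A_{μj} ≤ exp(-ρ + c₅(D log M₁ + LM₁))`). [cite: Diaz1989, §II-3-2 (a) (4) p. 8] -/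
theorem norm_Aterm_le (u : Fin n → ℂ) (v : Fin m → ℂ) (p : Unk m n D L M → ℤ) {H A ε : ℝ}
    (hH0 : 0 ≤ H) (hH : ∀ w, |(p w : ℝ)| ≤ H) (hA : 1 ≤ A) (hε0 : 0 ≤ ε) {θ' : Var m n → ℂ}
    (hθ : ∀ i, ‖theta u v i‖ ≤ A) (hθ' : ∀ i, ‖θ' i‖ ≤ A) (hε : ∀ i, ‖theta u v i - θ' i‖ ≤ ε)
    {M₁ : ℕ} {μ : Fin m → ℕ} (hμ : ∀ k, μ k < M₁) (j : Var m n →₀ ℕ) :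
    ‖Aterm u v p μ j θ'‖ ≤ Fintype.card (DL n D L) * (Pmax m n D L M H A * T0 m n D L M * ε) *
      ((1 + M₁ * ∑ k, ‖v k‖) ^ D * Real.exp (L * (∑ h, ‖u h‖) * (M₁ * ∑ k, ‖v k‖))) := by
  unfold Aterm
  refine (norm_sum_le _ _).trans ?_
  rw [mul_assoc]
  refine sum_univ_le_card_mul _ _ fun a => ?_
  rw [norm_mul]
  exact mul_le_mul (norm_aeval_Pj_sub_le p hH0 hH hA hε0 hθ hθ' hε a j)
    (norm_aeval_Rfac_le u v a hμ) (norm_nonneg _) (by unfold Pmax; positivity)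

/-- **(b)** for `|μ| < M` (where `Q_μ = 0`) and `j` minimal at `θ̃`:
`|F̃(μ.v)| ≤ #DL · Pmax · (mM)^D T₁(M) A^{T₁(M)} ε` (Diaz 1989, (5):
`B_{μj} ≤ exp(-ρ + c₈(D log M + LM))`). [cite: Diaz1989, §II-3-2 (b) (5) p. 9] -/
theorem norm_Ft_muv_le_of_vanish (hm : 1 ≤ m) (u : Fin n → ℂ) (v : Fin m → ℂ)
    {p : Unk m n D L M → ℤ} {H A ε : ℝ} (hH0 : 0 ≤ H) (hH : ∀ w, |(p w : ℝ)| ≤ H) (hA : 1 ≤ A)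
    (hε0 : 0 ≤ ε) {θ' : Var m n → ℂ} (hθ : ∀ i, ‖theta u v i‖ ≤ A) (hθ' : ∀ i, ‖θ' i‖ ≤ A)
    (hε : ∀ i, ‖theta u v i - θ' i‖ ≤ ε) {μ : Fin m → ℕ} (hμ : ∀ k, μ k < M) (hQ : Q p μ = 0)
    {j : Var m n →₀ ℕ} (hj : IsMinIdx p θ' j) :
    ‖Ft u p j θ' (muv v μ)‖ ≤ Fintype.card (DL n D L) * Pmax m n D L M H A *
      (((m : ℝ) * M) ^ D * T1 m n D L M * A ^ T1 m n D L M * ε) := by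
  rw [Ft_muv_eq_of_vanish u v hQ hj]
  refine (norm_sum_le _ _).trans ?_
  rw [mul_assoc]
  refine sum_univ_le_card_mul _ _ fun a => ?_
  rw [norm_mul]
  exact mul_le_mul (norm_aeval_Pj_le p hH0 hH hA hθ' a j)
    (norm_aeval_Rfac_sub_le hm a hμ hA hε0 hθ hθ' hε) (norm_nonneg _) (by unfold Pmax; positivity)

/-- **Growth of `F̃`**: `|F̃(z)| ≤ #DL · Pmax · max(1,|z|)^D · e^{LU|z|}` (Diaz 1989, p. 10:
`|F̃|_R ≤ exp c₁₀(D log R + LR)`). [cite: Diaz1989, §II-3-2 (c) p. 10] -/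
theorem norm_Ft_le (u : Fin n → ℂ) (p : Unk m n D L M → ℤ) {H A : ℝ} (hH0 : 0 ≤ H)
    (hH : ∀ w, |(p w : ℝ)| ≤ H) (hA : 1 ≤ A) {θ' : Var m n → ℂ} (hθ' : ∀ i, ‖θ' i‖ ≤ A)
    (j : Var m n →₀ ℕ) (z : ℂ) :
    ‖Ft u p j θ' z‖ ≤ Fintype.card (DL n D L) * Pmax m n D L M H A *
      ((max 1 ‖z‖) ^ D * Real.exp (L * (∑ h, ‖u h‖) * ‖z‖)) := by
  unfold Ft
  refine (norm_sum_le _ _).trans ?_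
  rw [mul_assoc]
  refine sum_univ_le_card_mul _ _ fun a => ?_
  rw [norm_mul]
  refine mul_le_mul (norm_aeval_Pj_le p hH0 hH hA hθ' a j) ?_ (norm_nonneg _)
    (by unfold Pmax; positivity)
  rw [norm_mul, norm_pow, Complex.norm_exp]
  refine mul_le_mul ?_ ?_ (by positivity) (by positivity)
  · exact (pow_le_pow_left₀ (norm_nonneg _) (le_max_right _ _) _).trans
      (pow_le_pow_right₀ (le_max_left _ _) a.1.isLt.le)
  · refine Real.exp_le_exp.mpr ?_
    calc (lamu u a.2 * z).re ≤ ‖lamu u a.2 * z‖ := Complex.re_le_norm _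
      _ = ‖lamu u a.2‖ * ‖z‖ := norm_mul _ _
      _ ≤ (L * ∑ h, ‖u h‖) * ‖z‖ := mul_le_mul_of_nonneg_right (norm_lamu_le u a.2) (norm_nonneg _)

/-! ### (c)+(d): the upper bound for `|Q_{μj}(θ)|`, `|μ| < M₁` -/

/-- `V = ∑ |v_k|`. [folklore] -/
def Vsum (v : Fin m → ℂ) : ℝ := ∑ k, ‖v k‖

/-- `U = ∑ |u_h|`. [folklore] -/
def Usum (u : Fin n → ℂ) : ℝ := ∑ h, ‖u h‖

/-- The radius `r = M₁(V + 1)` of a disc containing `𝓔(M₁)` (Diaz 1989, p. 10: `r = c₉M₁`).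
[cite: Diaz1989, §II-3-2 (c) p. 10] -/
def rad (M₁ : ℕ) (v : Fin m → ℂ) : ℝ := M₁ * (Vsum v + 1)

/-- The bound `ε₁` of (b) for `|F̃|` on `𝓔(M)`. [cite: Diaz1989, §II-3-2 (b) (5) p. 9] -/
def eps1 (m n D L M : ℕ) (H A ε : ℝ) : ℝ :=
  Fintype.card (DL n D L) * Pmax m n D L M H A *
    (((m : ℝ) * M) ^ D * T1 m n D L M * A ^ T1 m n D L M * ε)

/-- The bound `B_R` for `|F̃|` on `|z| = R`. [cite: Diaz1989, §II-3-2 (c) p. 10] -/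
def Bgr (m n D L M : ℕ) (H A U R : ℝ) : ℝ :=
  Fintype.card (DL n D L) * Pmax m n D L M H A * ((max 1 R) ^ D * Real.exp (L * U * R))

/-- The lower bound `Λ = (δ ω^M)^{M^{m-1}}` for the products over `𝓔(M)` (`DiazPoints.lean`).
[cite: Diaz1989, §II-3-2 (c) p. 10] -/
def LamLB (m' M : ℕ) (δ : ℝ) (v : Fin (m' + 1) → ℂ) : ℝ :=
  (δ * (min 1 (‖v (Fin.last m')‖ / 2)) ^ M) ^ (M ^ m')

/-- The bound of (a) for `|A_{μj}|`, `|μ| < M₁`. [cite: Diaz1989, §II-3-2 (a) (4) p. 8] -/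
def TAb (m n D L M : ℕ) (H A ε : ℝ) (M₁ : ℕ) (U V : ℝ) : ℝ :=
  Fintype.card (DL n D L) * (Pmax m n D L M H A * T0 m n D L M * ε) *
    ((1 + M₁ * V) ^ D * Real.exp (L * U * (M₁ * V)))

/-- **The upper bound for `|Q_{μj}(θ)|`, `μ ∈ ℕ^m(M₁)`** (Diaz 1989, §II-3-2, (4)–(7), in closed
form before the choice of parameters): with `j` a minimal index at a point `θ̃` of the polydisc
`max|·| ≤ A` at distance `≤ ε` from `θ`, `Q_{μ'} = 0` for `|μ'| < M` (Siegel's step), the points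
`𝓔(M)` separated by `δ ∈ (0,1]`, `2 ≤ M ≤ M₁`, and `R > r = M₁(V+1)`:
`|Q_{μj}(θ)| ≤ TA + [S ε₁ (2r)^{S-1}/Λ + (2r/(R-r))^S (B_R + S ε₁ (R+r)^{S-1}/Λ)]`, `S = M^m`, where
`TA`, `ε₁`, `B_R`, `Λ` are the explicit bounds `TAb`, `eps1`, `Bgr`, `LamLB` of (a), (b), the growth
of `F̃`, and `prod_pts_erase_ge`.
[cite: Diaz1989, §II-3-2 (a)–(d), (4)–(7), pp. 8–11] -/
theorem norm_aeval_Qj_le {m' : ℕ} (u : Fin n → ℂ) (v : Fin (m' + 1) → ℂ)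
    {p : Unk (m' + 1) n D L M → ℤ} {H A ε : ℝ} (hH0 : 0 ≤ H) (hH : ∀ w, |(p w : ℝ)| ≤ H)
    (hA : 1 ≤ A) (hε0 : 0 ≤ ε) {θ' : Var (m' + 1) n → ℂ} (hθ : ∀ i, ‖theta u v i‖ ≤ A)
    (hθ' : ∀ i, ‖θ' i‖ ≤ A) (hε : ∀ i, ‖theta u v i - θ' i‖ ≤ ε)
    (hM2 : 2 ≤ M) {M₁ : ℕ} (hMM₁ : M ≤ M₁)
    (hvan : ∀ μ' : Fin (m' + 1) → ℕ, (∀ k, μ' k < M) → Q p μ' = 0)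
    {δ : ℝ} (hsep : Separated v M δ) (hδ : 0 < δ) (hδ1 : δ ≤ 1)
    {R : ℝ} (hR : rad M₁ v < R)
    {j : Var (m' + 1) n →₀ ℕ} (hj : IsMinIdx p θ' j) {μ : Fin (m' + 1) → ℕ} (hμ : ∀ k, μ k < M₁) :
    ‖aeval (theta u v) (Qj p μ j)‖ ≤
      TAb (m' + 1) n D L M H A ε M₁ (Usum u) (Vsum v) +
      ((M ^ (m' + 1) : ℕ) * eps1 (m' + 1) n D L M H A ε * (2 * rad M₁ v) ^ (M ^ (m' + 1) - 1) /
          LamLB m' M δ v +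
        (2 * rad M₁ v / (R - rad M₁ v)) ^ (M ^ (m' + 1)) *
          (Bgr (m' + 1) n D L M H A (Usum u) R + (M ^ (m' + 1) : ℕ) * eps1 (m' + 1) n D L M H A ε *
            (R + rad M₁ v) ^ (M ^ (m' + 1) - 1) / LamLB m' M δ v)) := by
  classical
  have hm : 1 ≤ m' + 1 := by omega
  have hV0 : 0 ≤ Vsum v := Finset.sum_nonneg fun _ _ => norm_nonneg _
  have hM₁pos : 0 < M₁ := by omega
  have hr : 0 < rad M₁ v := by
    unfold rad
    have : (0 : ℝ) < M₁ := by exact_mod_cast hM₁pos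
    positivity
  -- the decomposition
  rw [aeval_Qj_eq_A_add_Ft u v p μ j θ']
  refine (norm_add_le _ _).trans (add_le_add ?_ ?_)
  · exact norm_Aterm_le u v p hH0 hH hA hε0 hθ hθ' hε hμ j
  -- the interpolation estimate on `𝓔(M)`
  have hcard : (pts v M).card = M ^ (m' + 1) := card_pts hsep hδ
  have hlast : δ ≤ ‖v (Fin.last m')‖ := le_norm_last_of_separated hsep hM2
  have hω : 0 < min 1 (‖v (Fin.last m')‖ / 2) := lt_min one_pos (by linarith)
  have hΛ : 0 < LamLB m' M δ v := by unfold LamLB; positivity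
  have hE : (pts v M).Nonempty :=
    ⟨muv v 0, Finset.mem_image_of_mem _ (Behrend.mem_box.mpr fun k => by
      simp only [Pi.zero_apply]; omega)⟩
  have hEr : ∀ e ∈ pts v M, ‖e‖ ≤ rad M₁ v := by
    intro e he
    refine (norm_le_of_mem_pts v he).trans ?_
    unfold rad Vsum
    have h1 : (M : ℝ) ≤ M₁ := by exact_mod_cast hMM₁
    have h2 : (∑ k, ‖v k‖) ≤ (∑ k, ‖v k‖) + 1 := by linarith
    exact mul_le_mul h1 h2 hV0 (by positivity)
  have hfR : ∀ z : ℂ, ‖z‖ = R → ‖Ft u p j θ' z‖ ≤ Bgr (m' + 1) n D L M H A (Usum u) R := by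
    intro z hz
    have := norm_Ft_le u p hH0 hH hA hθ' j z
    rw [hz] at this
    exact this
  have hfE : ∀ e ∈ pts v M, ‖Ft u p j θ' e‖ ≤ eps1 (m' + 1) n D L M H A ε := by
    intro e he
    obtain ⟨μ', hμ', rfl⟩ := Finset.mem_image.mp he
    have hμ'' := Behrend.mem_box.mp hμ'
    exact norm_Ft_muv_le_of_vanish hm u v hH0 hH hA hε0 hθ hθ' hε hμ'' (hvan μ' hμ'') hj
  have hprod : ∀ e ∈ pts v M, LamLB m' M δ v ≤
      ∏ e' ∈ (pts v M).erase e, ‖e - e'‖ := fun e he =>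
    prod_pts_erase_ge v hsep hδ hδ1 he
  have hw : ‖muv v μ‖ ≤ rad M₁ v := by
    refine (norm_muv_le v hμ).trans ?_
    unfold rad Vsum
    exact mul_le_mul_of_nonneg_left (by linarith) (by positivity)
  have key := Interp.norm_le_of_small_on_finset (differentiable_Ft u p j θ') (pts v M)
    hE hr hR hEr hfR hfE hΛ hprod hw
  rw [hcard] at key
  exact key

/-! ### Degree and length of `Q_{μj}` (Diaz 1989, (8), (9)) -/

/-- **`deg Q_{μj} ≤ T₀ + T₁(M')`** for `μ ∈ ℕ^m(M')` (Diaz 1989, (8): `deg Q_{μj} ≤ c₁₄(D + LM₁)`).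
[cite: Diaz1989, §II-3-3 (8) p. 11] -/
theorem totalDegree_Qj_le (p : Unk m n D L M → ℤ) {M' : ℕ} {μ : Fin m → ℕ} (hμ : ∀ k, μ k < M')
    (j : Var m n →₀ ℕ) : (Qj p μ j).totalDegree ≤ T0 m n D L M + T1 m n D L M' := by
  classical
  unfold Qj
  refine totalDegree_finsetSum_le fun a _ => (totalDegree_mul _ _).trans ?_
  exact Nat.add_le_add (totalDegree_Pj_le p a j) (totalDegree_Rfac_le a hμ)

/-- **`L(Q_{μj}) ≤ #DL · 2^{T₀} #ExpIdx H · (mM')^D`** for `μ ∈ ℕ^m(M')`, `m ≥ 1` (Diaz 1989, (8):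
`H(Q_{μj}) ≤ exp c₁₅(D log M₁ + LM)`). [cite: Diaz1989, §II-3-3 (8), (9) p. 11] -/
theorem l1_Qj_le (hm : 1 ≤ m) (p : Unk m n D L M → ℤ) {H : ℝ} (hH : ∀ w, |(p w : ℝ)| ≤ H)
    {M' : ℕ} {μ : Fin m → ℕ} (hμ : ∀ k, μ k < M') (j : Var m n →₀ ℕ) :
    l1 (Qj p μ j) ≤ Fintype.card (DL n D L) *
      (2 ^ T0 m n D L M * (Fintype.card (ExpIdx m n D L M) * H) * (((m : ℝ) * M') ^ D)) := by
  classical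
  unfold Qj
  refine (wnorm_sum_le _ _ _).trans (sum_univ_le_card_mul _ _ fun a => ?_)
  refine (wnorm_mul_le _ _ _).trans ?_
  exact mul_le_mul (l1_Pj_le p hH a j) (l1_Rfac_le hm a hμ) (wnorm_nonneg _ _) (by
    have := (wnorm_nonneg (normRingSeminorm ℤ) (Pj p a j)).trans (l1_Pj_le p hH a j)
    exact this)

end DiazThm1





end Literature.NumberTheory.Transcendental

end
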